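import Summits.BirchSwinnertonDyer.BirchSwinnertonDyer.Theorems.Rank1ResidualX9ChaCertificate
import Literature.NumberTheory.EllipticCurves.Rank1Residual.Typed.X10bHeegnerIndexCertificate
import Literature.NumberTheory.EllipticCurves.Rank1Residual.Typed.X11Visibility
import Literature.NumberTheory.EllipticCurves.KrausOesterle1992.TorsionCongruenceCriterion
import HarnessLib

/-!
# BSD rank-≤1 residual cell, class X9: the rank-`0` pairs with `p² ‖ #Ш_an` — Cha's upper bound
# meets a VISIBLE lower bound (a `p`-congruent curve of rank `≥ 2`), per pair

HONEST FRAMING (cell `b2b-bsdres-*`, verbatim): the goal of the cell is to DELETE the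
COMBINATION-SHAPED residual classes for ALL analytic-rank ≤ 1 curves over ℚ — "full BSD formula
for every rank ≤ 1 curve in class C" assembled STRICTLY from published theorems — so that the
rank-≤1 remainder becomes exactly the CONSTRUCTION-SHAPED classes, which are TYPED (missing-input
Props), NOT attempted; this is not "finishing BSD".

Theorems only (helper file of the statement item `SelmerRankSmallImage`,
stmt-BirchSwinnertonDyer-14418; X9 prover gen 8). X9's label (typed; `(im)` unsatisfiable,
`ClassX9.not_bigIm`; residue = Greenberg's μ-conjecture instance pair by pair) is NOT changed here.
NO new named fact: pure compositions of tree theorems with the PUBLISHED named facts already in the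
tree — Cha 2005 (`hCha` = `Cha2005.thm52_padicValNat_shaOrder_le`, Miller 2011 Thm. 5.2: the
Heegner-index bound `ord_p #Ш(E/ℚ) ≤ 2·ord_p [E(K) : ℤ y_K]` for `ρ̄_{E,p}` IRREDUCIBLE),
Cassels–Tate (`hCT`, bsd.S18), Gross–Zagier–Kolyvagin (`hGZK`, bsd.S17) and, for the finite form of
the congruence certificate, Kraus–Oesterlé 1992 Prop. 4 (`hKO` =
`KrausOesterle1992.prop4_torsionIso_of_congruences`).

**The situation.** In the X9 census of Heegner-index certificates (N < 5·10⁵, 790 pairs,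
HOME/b2b-bsdres-x9/X9-CENSUS-G7.md §4, G8 §2) the rank-`0` pairs with `p ∣ #Ш_an` ("SHA rows",
13 at `p = 5`, all with `ord_5 #Ш_an = 2`, and `378225bn1` at `p = 7` with `#Ш_an = 49`) have their
UPPER half in print per pair — Cha's bound with an index certificate `ord_p [E(K) : ℤ y_K] ≤ 1`
(two engines) gives `ord_p #Ш(E/ℚ) ≤ 2` — and were missing exactly the LOWER certificate
`Ш(E/ℚ)[p] ≠ 0` (`Typed.bsdp_of_cha_of_casselsTate_of_dvd`, unit x10b). Wuthrich's Prop. 21, the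
upper bound of the cell's other visibility files (`Typed/VisibilityCertificate.lean`,
`Typed/X11Visibility.lean`, prover x11a), is NOT available on X9 (it requires `ρ̄` surjective or
Borel). This file supplies the lower certificate by VISIBILITY, through the tree's KERNEL theorem
`WeierstrassCurve.exists_sha_ne_zero_of_congr_of_rank` (`CongruenceVisibilityLocalFactors.lean`:
the dimension count of Cremona–Mazur 2000 §3 / Agashe–Stein 2002 Thm. 3.1 for a `Γ_ℚ`-isomorphism
`θ : E'[p] ≅ E[p]`, an odd `p`, `E(ℚ)` finite of order prime to `p`, `rank E'(ℚ) ≥ 2`, and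
`E'(ℚ_v)[p] = 0` on a finite set `S` of primes containing `p` outside which both curves have good
reduction — no condition "`p ∤ N`", no Jacobian), and — new for X9 — observes that on the
Cartan-normaliser part of X9 the congruent curve is CANONICAL: if `ρ̄_{E,p}` has image in the
normaliser of a Cartan subgroup with quadratic field `M`, then `ρ̄ ⊗ χ_M ≅ ρ̄`, so the quadratic
twist `E^{(M)}` satisfies `E^{(M)}[p] ≅ E[p]`; whenever `E^{(M)}` has the same conductor and rank
`≥ 2`, it is a visibility partner (census instances below: `131043s1 ↔ 131043t1 = E^{(−11)}` at
`p = 5`, `378225bn1 ↔ 378225bm1 = E^{(−3)}` at `p = 7`).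

* `bsdp_of_cha_of_congr_of_rank_two` — CLASS-FREE, rank `0`, odd `p`, `E` non-CM with `E[p]`
  irreducible, `ord_p #Ш_an = 2`: the Heegner-index certificate `ord_p [E(K) : ℤ y_K] ≤ 1`
  (`K` Heegner for the level `N`, `p ∤ d_K`, `p² ∤ N`) plus a partner `E' = W'` with
  `θ : E'[p] ≃ E[p]` `Γ_ℚ`-equivariant, `rank E'(ℚ) ≥ 2`, and the local conditions on `S`
  ⇒ Miller's `BSDp W p`; `padicValNat_shaOrder_eq_two_of_cha_of_congr_of_rank_two` — under the same
  data `ord_p #Ш(E/ℚ) = 2` EXACTLY;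
* `bsdp_of_cha_of_krausOesterle_of_rank_two` — the same with `θ` REPLACED by the finite
  Kraus–Oesterlé certificate: the trace congruences `a_ℓ(E) ≡ a_ℓ(E') (mod p)` (and
  `a_ℓ a'_ℓ ≡ ℓ + 1` at `v_ℓ(NN') = 1`) for all primes `6ℓ < μ(M)` (`hcong`), granted `hKO`;
* `bsdp_of_classX9_of_visibleCongruence` / `…_of_krausOesterleCongruence` — over this file's
  `ClassX9` (the Summit's), where `E` non-CM, `p ≥ 5` and `E[p]` irreducible are AUTOMATIC: the
  typed target `BSDpOnClassX9` DELIVERED POINTWISE at a rank-`0` SHA row carrying the two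
  certificates; `missingInputAt_of_classX9_of_visibleCongruence` — the typed missing input
  `Typed.X9.MissingInputAt` DISCHARGED there; `mu_eq_zero_of_classX9_of_visibleCongruence` —
  Greenberg's `μ = 0` for `X(E/ℚ_∞)` FOLLOWS at such a pair (gen 5's μ-typing
  `Rank1Residual.X9.mu_eq_zero_of_bsdp`, granted its finite analytic certificate `hcert`).
Per pair; NOT class theorems (`BSDpOnClassX9`, `IntegralMainConjectureOnClassX9` stay OPEN as
∀-statements). The lane books certificates; the referee rules.

**Census instances (X9 prover gen 8, HOME/b2b-bsdres-x9/X9-CENSUS-G8.md §3; two engines each —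
stdlib Python `vis_cert.py` and PARI/GP `vis_cert_e1.gp` for the congruence / rank / local data,
GP + stdlib `run_cert.py` for the Heegner index).** `131043s1` (`N = 3·11²·19²`, `5Ns`, `r = 0`,
`#Ш_an = 25`, `∏c_q = 4`, `#E(ℚ) = 1`, single-curve isogeny class): Heegner field `ℚ(√−2)`
(`D = −8`), `m = 40`, `ord_5 [E(K) : ℤ y_K] = 1` (two engines) ⇒ `ord_5 #Ш ≤ 2`; partner
`131043t1 = E^{(−11)} = [0,−1,1,−2822057,1849406954]`, rank `2` (generators `(906, 5956)`,
`(63204/49, 6450718/343)`, independent in `E'(ℚ)/5` by the reduction functionals at `ℓ = 29, 37`),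
`a_ℓ(E) ≡ a_ℓ(E') (mod 5)` for all `3580` primes `ℓ ≤ 33440 = μ(131043)/6` (both engines; `S` of
Kraus–Oesterlé empty: both curves non-split at `3`), `E'(ℚ_v)[5] = 0` for `v ∈ {3, 5, 11, 19}`
(`#Ẽ'_ns(𝔽_v)·c_v(E') = 4·1, 11·2, 19·4` at `v = 3, 11, 19`; `#Ẽ'(𝔽_5) = 4`) ⇒ `5 ∣ #Ш(E)`,
Cassels–Tate ⇒ `25 ∣ #Ш(E)` ⇒ `#Ш(E)[5^∞] = 25 = #Ш_an[5^∞]` and `BSD(E,5)`. `378225bn1`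
(`N = 3²·5²·41²`, `7Ns`, `r = 0`, `#Ш_an = 49`): partner `378225bm1 = E^{(−3)}` of rank `2`
(also the CM curves `378225x1`, `378225x2`), congruent mod `7` at all `9876` primes
`ℓ ≤ 103320 = μ/6`, `E'(ℚ_v)[7] = 0` on `{3, 5, 7, 41}` ⇒ `7 ∣ #Ш(E)`; its Heegner-index row is
pending at filing (no rational point on the rank-one twist found yet), so only the LOWER half is
certified there. Nothing here is booked by this seat.

References: Cha 2005 [Cha2005] via Miller 2011 Thm. 5.2 [Miller2011LMS]; Cremona–Mazur 2000 §3
[CremonaMazur2000]; Agashe–Stein 2002 Thm. 3.1 [AgasheStein2002]; Kraus–Oesterlé 1992 Prop. 4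
[KrausOesterle1992]; Cassels 1962 / Silverman AEC X.4.14 [SilvermanAEC2009]; Mazur 1977 III.§5
[Mazur1977]; cell files `Typed/X10bHeegnerIndexCertificate.lean` (x10b), `Typed/X11Visibility.lean`
(x11a), `Rank1ResidualX9ChaCertificate.lean` (x9 gen 6), `Rank1ResidualX9JetchevCha.lean` (gen 7).
-/

set_option linter.dupNamespace false

noncomputable section

open scoped Classical MatrixGroups ModularForm

open CongruenceSubgroup WeierstrassCurve Literature.NumberTheory.EllipticCurves
  Literature.NumberTheory.EllipticCurves.ModularForms
  Literature.NumberTheory.EllipticCurves.Rank1Residual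
  Literature.NumberTheory.EllipticCurves.Cha2005
  Literature.NumberTheory.EllipticCurves.KrausOesterle1992
open NumberField IsDedekindDomain

namespace Summit.BirchSwinnertonDyer.BirchSwinnertonDyer.Rank1Residual

/-! ### Class-free: rank `0`, odd `p`, `ord_p #Ш_an = 2` -/

/-- **Rank `0`, odd `p`, `E` non-CM with `E[p]` irreducible, `ord_p #Ш_an = 2`: `BSD(E,p)` from
PUBLISHED theorems plus TWO finite certificates — a Heegner-index certificate (UPPER half, Cha) and a
`p`-congruent curve of rank `≥ 2` (LOWER half, visibility).** Published binders: Cha 2005 (`hCha`,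
Miller Thm. 5.2), Cassels–Tate (`hCT`), Gross–Zagier–Kolyvagin (`hGZK`). Per-curve data: the Heegner
field `K` (imaginary quadratic, Heegner hypothesis for the level `N`, `p ∤ d_K`, `p² ∤ N`), a Heegner
point `P` of infinite order with `ord_p [E(K) : ℤ P] ≤ 1`, `#Ш_an = q` with `ord_p q = 2`; the
partner `E' = W'` with a `Γ_ℚ`-equivariant `θ : E'[p] ≃ E[p]`, `rank E'(ℚ) ≥ 2`, a finite set `S` of
primes (outside: good reduction of both, `v ∤ p`) with `E'(ℚ_v)[p] = 0` for `v ∈ S`. Kernel: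
`exists_sha_ne_zero_of_congr_of_rank` (a non-zero class in `Ш(E)[p]`; `E(ℚ)` finite by GZK, of order
prime to `p` by irreducibility) and `Typed.bsdp_of_cha_of_casselsTate_of_dvd`. NOT a class theorem.
[cite: Miller2011LMS, Thm. 5.2 and Def. 1.1] [cite: CremonaMazur2000, §3 pp. 19–22]
[cite: AgasheStein2002, Thm. 3.1] [cite: SilvermanAEC2009, Thm. X.4.14] -/
theorem bsdp_of_cha_of_congr_of_rank_two (hCha : thm52_padicValNat_shaOrder_le)
    (hCT : exists_casselsTate_pairing (K := ℚ))
    (hGZK : rank_eq_analyticRank_of_analyticRank_le_one)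
    (W : WeierstrassCurve ℚ) [W.IsElliptic] [W.IsGloballyMinimal] (p : ℕ) [Fact p.Prime]
    (hcm : ¬ W.HasCM) (hp2 : p ≠ 2) (hirr : Irr W p) (hr0 : W.analyticRank = 0)
    {N : ℕ} [NeZero N] {K : Type} [Field K] [NumberField K] (hK : IsImaginaryQuadratic K)
    (hH : SatisfiesHeegnerHypothesis N K) {P : (W.baseChange K).toAffine.Point}
    (hP : IsHeegnerPoint N W K P) (hnt : ¬ IsOfFinAddOrder P)
    (hpD : ¬ (p : ℤ) ∣ NumberField.discr K) (hpN : ¬ p ^ 2 ∣ N)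
    (hI : padicValNat p (AddSubgroup.zmultiples P).index ≤ 1)
    {q : ℚ} (hq : shaAn W = (q : ℂ)) (hv : padicValRat p q = 2)
    (W' : WeierstrassCurve ℚ) [W'.IsElliptic]
    (θ : geomTorsion W' (p : ℤ) ≃+ geomTorsion W (p : ℤ))
    (hθ : ∀ (σ : Field.absoluteGaloisGroup ℚ) (T : geomTorsion W' (p : ℤ)), θ (σ • T) = σ • θ T)
    (hrank : 2 ≤ W'.mordellWeilRank) (S : Finset (HeightOneSpectrum (𝓞 ℚ)))
    (hS : ∀ v : HeightOneSpectrum (𝓞 ℚ), v ∉ S →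
      W.HasGoodReductionAt v ∧ W'.HasGoodReductionAt v ∧ (p : 𝓞 ℚ) ∉ v.asIdeal)
    (hloc : ∀ v ∈ S, Nat.card (nsmulAddMonoidHom p :
      (W'.baseChange (v.adicCompletion ℚ)).toAffine.Point →+ _).ker = 1) :
    BSDp W p := by
  haveI : Finite W.toAffine.Point := Typed.finite_point_of_analyticRank_eq_zero W hGZK hr0
  have hrank' : Module.finrank ℚ ℚ + 1 ≤ W'.mordellWeilRank := by rwa [Module.finrank_self]
  have hdvd : p ∣ W.shaOrder :=
    Typed.dvd_shaOrder_of_exists_torsion W p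
      (W.exists_sha_ne_zero_of_congr_of_rank W' hp2 θ hθ S hS ‹_›
        (Typed.coprime_natCard_point_of_irr W p hirr) hrank' hloc)
  have hr1 : W.analyticRank ≤ 1 := by rw [hr0]; norm_num
  exact Typed.bsdp_of_cha_of_casselsTate_of_dvd W p hGZK hCT hCha hcm hr1 hK hH hP hnt hp2 hpD hpN
    hirr (k := 1) hI hq (by rw [hv]; norm_num) (by simpa using hdvd)

/-- **The exact `p`-part under the same data: `ord_p #Ш(E/ℚ) = 2`** — the visible class and
Cassels–Tate squareness give `p² ∣ #Ш`, Cha's bound with the index certificate gives `≤ 2`; no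
`#Ш_an` needed. [cite: Miller2011LMS, Thm. 5.2] [cite: CremonaMazur2000, §3]
[cite: SilvermanAEC2009, Thm. X.4.14] -/
theorem padicValNat_shaOrder_eq_two_of_cha_of_congr_of_rank_two
    (hCha : thm52_padicValNat_shaOrder_le) (hCT : exists_casselsTate_pairing (K := ℚ))
    (hGZK : rank_eq_analyticRank_of_analyticRank_le_one)
    (W : WeierstrassCurve ℚ) [W.IsElliptic] [W.IsGloballyMinimal] (p : ℕ) [Fact p.Prime]
    (hcm : ¬ W.HasCM) (hp2 : p ≠ 2) (hirr : Irr W p) (hr0 : W.analyticRank = 0)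
    {N : ℕ} [NeZero N] {K : Type} [Field K] [NumberField K] (hK : IsImaginaryQuadratic K)
    (hH : SatisfiesHeegnerHypothesis N K) {P : (W.baseChange K).toAffine.Point}
    (hP : IsHeegnerPoint N W K P) (hnt : ¬ IsOfFinAddOrder P)
    (hpD : ¬ (p : ℤ) ∣ NumberField.discr K) (hpN : ¬ p ^ 2 ∣ N)
    (hI : padicValNat p (AddSubgroup.zmultiples P).index ≤ 1)
    (W' : WeierstrassCurve ℚ) [W'.IsElliptic]
    (θ : geomTorsion W' (p : ℤ) ≃+ geomTorsion W (p : ℤ))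
    (hθ : ∀ (σ : Field.absoluteGaloisGroup ℚ) (T : geomTorsion W' (p : ℤ)), θ (σ • T) = σ • θ T)
    (hrank : 2 ≤ W'.mordellWeilRank) (S : Finset (HeightOneSpectrum (𝓞 ℚ)))
    (hS : ∀ v : HeightOneSpectrum (𝓞 ℚ), v ∉ S →
      W.HasGoodReductionAt v ∧ W'.HasGoodReductionAt v ∧ (p : 𝓞 ℚ) ∉ v.asIdeal)
    (hloc : ∀ v ∈ S, Nat.card (nsmulAddMonoidHom p :
      (W'.baseChange (v.adicCompletion ℚ)).toAffine.Point →+ _).ker = 1) :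
    padicValNat p W.shaOrder = 2 := by
  haveI : Finite W.toAffine.Point := Typed.finite_point_of_analyticRank_eq_zero W hGZK hr0
  have hrank' : Module.finrank ℚ ℚ + 1 ≤ W'.mordellWeilRank := by rwa [Module.finrank_self]
  have hdvd : p ∣ W.shaOrder :=
    Typed.dvd_shaOrder_of_exists_torsion W p
      (W.exists_sha_ne_zero_of_congr_of_rank W' hp2 θ hθ S hS ‹_›
        (Typed.coprime_natCard_point_of_irr W p hirr) hrank' hloc)
  have hr1 : W.analyticRank ≤ 1 := by rw [hr0]; norm_num
  simpa using Typed.padicValNat_shaOrder_eq_of_cha_of_casselsTate_of_dvd W p hGZK hCT hCha hcm hr1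
    hK hH hP hnt hp2 hpD hpN hirr (k := 1) hI (by simpa using hdvd)

/-- **The same `BSD(E,p)` with the congruence certificate in FINITE form (Kraus–Oesterlé 1992
Prop. 4, `hKO`).** Instead of the isomorphism `θ`, the per-pair input is the finite list of trace
congruences of Prop. 4 (ii) for the globally minimal models `W`, `W'`: for every prime `ℓ` with
`6ℓ < μ(M)`, `M` the Kraus–Oesterlé modulus, `a_ℓ(E) ≡ a_ℓ(E') (mod p)` when `ℓ ∤ NN'` and
`a_ℓ(E)·a_ℓ(E') ≡ ℓ + 1 (mod p)` when `v_ℓ(NN') = 1` (`hcong`; for partners of the same conductor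
with no split/non-split mismatch `M = N` and the second clause is void). `E[p]` irreducible makes
Prop. 4's conclusion an honest `Γ_ℚ`-isomorphism `E'[p] ≃ E[p]`
(`KrausOesterle1992.torsionIso_of_congruences`). Census use: `131043s1 ↔ 131043t1` at `p = 5`
(`3580` primes `ℓ < 33440`), see the module docstring. NOT a class theorem.
[cite: KrausOesterle1992, Prop. 4, pp. 263–264] [cite: Miller2011LMS, Thm. 5.2 and Def. 1.1]
[cite: CremonaMazur2000, §3] [cite: SilvermanAEC2009, Thm. X.4.14] -/
theorem bsdp_of_cha_of_krausOesterle_of_rank_two (hKO : prop4_torsionIso_of_congruences)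
    (hCha : thm52_padicValNat_shaOrder_le) (hCT : exists_casselsTate_pairing (K := ℚ))
    (hGZK : rank_eq_analyticRank_of_analyticRank_le_one)
    (W : WeierstrassCurve ℚ) [W.IsElliptic] [W.IsGloballyMinimal] (p : ℕ) [Fact p.Prime]
    (hcm : ¬ W.HasCM) (hp2 : p ≠ 2) (hirr : Irr W p) (hr0 : W.analyticRank = 0)
    {N : ℕ} [NeZero N] {K : Type} [Field K] [NumberField K] (hK : IsImaginaryQuadratic K)
    (hH : SatisfiesHeegnerHypothesis N K) {P : (W.baseChange K).toAffine.Point}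
    (hP : IsHeegnerPoint N W K P) (hnt : ¬ IsOfFinAddOrder P)
    (hpD : ¬ (p : ℤ) ∣ NumberField.discr K) (hpN : ¬ p ^ 2 ∣ N)
    (hI : padicValNat p (AddSubgroup.zmultiples P).index ≤ 1)
    {q : ℚ} (hq : shaAn W = (q : ℂ)) (hv : padicValRat p q = 2)
    (W' : WeierstrassCurve ℚ) [W'.IsElliptic] [W'.IsGloballyMinimal]
    (hcong : ∀ (ℓ : ℕ) [Fact ℓ.Prime], 6 * ℓ < gammaZeroIndex (modulus W W') →
      (padicValNat ℓ (W.conductorNorm ℤ * W'.conductorNorm ℤ) = 0 →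
          (p : ℤ) ∣ W.frobeniusTrace ℓ - W'.frobeniusTrace ℓ) ∧
        (padicValNat ℓ (W.conductorNorm ℤ * W'.conductorNorm ℤ) = 1 →
          (p : ℤ) ∣ W.frobeniusTrace ℓ * W'.frobeniusTrace ℓ - (ℓ + 1)))
    (hrank : 2 ≤ W'.mordellWeilRank) (S : Finset (HeightOneSpectrum (𝓞 ℚ)))
    (hS : ∀ v : HeightOneSpectrum (𝓞 ℚ), v ∉ S →
      W.HasGoodReductionAt v ∧ W'.HasGoodReductionAt v ∧ (p : 𝓞 ℚ) ∉ v.asIdeal)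
    (hloc : ∀ v ∈ S, Nat.card (nsmulAddMonoidHom p :
      (W'.baseChange (v.adicCompletion ℚ)).toAffine.Point →+ _).ker = 1) :
    BSDp W p := by
  obtain ⟨θ, hθ⟩ := torsionIso_of_congruences hKO W W' p hirr hcong
  exact bsdp_of_cha_of_congr_of_rank_two hCha hCT hGZK W p hcm hp2 hirr hr0 hK hH hP hnt hpD hpN hI
    hq hv W' θ hθ hrank S hS hloc

/-! ### Class X9 (this file's `ClassX9`: non-CM, `p ≥ 5` good ordinary, `E[p]` irreducible, `¬surj`) -/

/-- **X9 ∧ `r = 0` ∧ `ord_p #Ш_an = 2`: the typed target `BSDpOnClassX9` DELIVERED POINTWISE by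
the Heegner-index certificate (upper, Cha) and a `p`-congruent curve of rank `≥ 2` (lower,
visibility).** On `ClassX9 W p` the Galois hypotheses of Cha's bound and of the visibility count are
AUTOMATIC (`E` non-CM, `p ≥ 5` odd, `E[p]` irreducible — so `p ∤ #E(ℚ)`); what remains per pair
are the finite certificates listed in `bsdp_of_cha_of_congr_of_rank_two`. On the Cartan-normaliser
part of X9 the natural partner is the quadratic twist by the Cartan field `M`
(`E^{(M)}[p] ≅ E[p]`); census: `131043s1@5` with `E' = 131043t1 = E^{(−11)}` (module docstring).
PUBLISHED binders `hCha`, `hCT`, `hGZK`; nothing announced; NOT a class theorem — `BSDpOnClassX9`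
stays OPEN as a ∀-statement. [cite: Miller2011LMS, Thm. 5.2 and Def. 1.1]
[cite: CremonaMazur2000, §3 pp. 19–22] [cite: AgasheStein2002, Thm. 3.1]
[cite: SilvermanAEC2009, Thm. X.4.14] -/
theorem bsdp_of_classX9_of_visibleCongruence (hCha : thm52_padicValNat_shaOrder_le)
    (hCT : exists_casselsTate_pairing (K := ℚ))
    (hGZK : rank_eq_analyticRank_of_analyticRank_le_one)
    (W : WeierstrassCurve ℚ) [W.IsElliptic] [W.IsGloballyMinimal] (p : ℕ) [Fact p.Prime]
    (hX9 : ClassX9 W p) (hr0 : W.analyticRank = 0)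
    {N : ℕ} [NeZero N] {K : Type} [Field K] [NumberField K] (hK : IsImaginaryQuadratic K)
    (hH : SatisfiesHeegnerHypothesis N K) {P : (W.baseChange K).toAffine.Point}
    (hP : IsHeegnerPoint N W K P) (hnt : ¬ IsOfFinAddOrder P)
    (hpD : ¬ (p : ℤ) ∣ NumberField.discr K) (hpN : ¬ p ^ 2 ∣ N)
    (hI : padicValNat p (AddSubgroup.zmultiples P).index ≤ 1)
    {q : ℚ} (hq : shaAn W = (q : ℂ)) (hv : padicValRat p q = 2)
    (W' : WeierstrassCurve ℚ) [W'.IsElliptic]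
    (θ : geomTorsion W' (p : ℤ) ≃+ geomTorsion W (p : ℤ))
    (hθ : ∀ (σ : Field.absoluteGaloisGroup ℚ) (T : geomTorsion W' (p : ℤ)), θ (σ • T) = σ • θ T)
    (hrank : 2 ≤ W'.mordellWeilRank) (S : Finset (HeightOneSpectrum (𝓞 ℚ)))
    (hS : ∀ v : HeightOneSpectrum (𝓞 ℚ), v ∉ S →
      W.HasGoodReductionAt v ∧ W'.HasGoodReductionAt v ∧ (p : 𝓞 ℚ) ∉ v.asIdeal)
    (hloc : ∀ v ∈ S, Nat.card (nsmulAddMonoidHom p :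
      (W'.baseChange (v.adicCompletion ℚ)).toAffine.Point →+ _).ker = 1) :
    BSDp W p := by
  obtain ⟨hcm, -, hp5, hirr, -, -⟩ := classX9_census_of_classX9 W p hX9
  have hp2 : p ≠ 2 := by omega
  exact bsdp_of_cha_of_congr_of_rank_two hCha hCT hGZK W p hcm hp2 hirr hr0 hK hH hP hnt hpD hpN hI
    hq hv W' θ hθ hrank S hS hloc

/-- **X9 ∧ `r = 0` ∧ `ord_p #Ш_an = 2`, Kraus–Oesterlé form**: as
`bsdp_of_classX9_of_visibleCongruence`, the congruence certificate given as the finite list of trace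
congruences of Kraus–Oesterlé's Prop. 4 (`hKO`, `hcong`) between the globally minimal models.
NOT a class theorem. [cite: KrausOesterle1992, Prop. 4, pp. 263–264]
[cite: Miller2011LMS, Thm. 5.2 and Def. 1.1] [cite: CremonaMazur2000, §3] -/
theorem bsdp_of_classX9_of_krausOesterleCongruence (hKO : prop4_torsionIso_of_congruences)
    (hCha : thm52_padicValNat_shaOrder_le) (hCT : exists_casselsTate_pairing (K := ℚ))
    (hGZK : rank_eq_analyticRank_of_analyticRank_le_one)
    (W : WeierstrassCurve ℚ) [W.IsElliptic] [W.IsGloballyMinimal] (p : ℕ) [Fact p.Prime]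
    (hX9 : ClassX9 W p) (hr0 : W.analyticRank = 0)
    {N : ℕ} [NeZero N] {K : Type} [Field K] [NumberField K] (hK : IsImaginaryQuadratic K)
    (hH : SatisfiesHeegnerHypothesis N K) {P : (W.baseChange K).toAffine.Point}
    (hP : IsHeegnerPoint N W K P) (hnt : ¬ IsOfFinAddOrder P)
    (hpD : ¬ (p : ℤ) ∣ NumberField.discr K) (hpN : ¬ p ^ 2 ∣ N)
    (hI : padicValNat p (AddSubgroup.zmultiples P).index ≤ 1)
    {q : ℚ} (hq : shaAn W = (q : ℂ)) (hv : padicValRat p q = 2)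
    (W' : WeierstrassCurve ℚ) [W'.IsElliptic] [W'.IsGloballyMinimal]
    (hcong : ∀ (ℓ : ℕ) [Fact ℓ.Prime], 6 * ℓ < gammaZeroIndex (modulus W W') →
      (padicValNat ℓ (W.conductorNorm ℤ * W'.conductorNorm ℤ) = 0 →
          (p : ℤ) ∣ W.frobeniusTrace ℓ - W'.frobeniusTrace ℓ) ∧
        (padicValNat ℓ (W.conductorNorm ℤ * W'.conductorNorm ℤ) = 1 →
          (p : ℤ) ∣ W.frobeniusTrace ℓ * W'.frobeniusTrace ℓ - (ℓ + 1)))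
    (hrank : 2 ≤ W'.mordellWeilRank) (S : Finset (HeightOneSpectrum (𝓞 ℚ)))
    (hS : ∀ v : HeightOneSpectrum (𝓞 ℚ), v ∉ S →
      W.HasGoodReductionAt v ∧ W'.HasGoodReductionAt v ∧ (p : 𝓞 ℚ) ∉ v.asIdeal)
    (hloc : ∀ v ∈ S, Nat.card (nsmulAddMonoidHom p :
      (W'.baseChange (v.adicCompletion ℚ)).toAffine.Point →+ _).ker = 1) :
    BSDp W p := by
  obtain ⟨hcm, -, hp5, hirr, -, -⟩ := classX9_census_of_classX9 W p hX9
  have hp2 : p ≠ 2 := by omega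
  exact bsdp_of_cha_of_krausOesterle_of_rank_two hKO hCha hCT hGZK W p hcm hp2 hirr hr0 hK hH hP hnt
    hpD hpN hI hq hv W' hcong hrank S hS hloc

/-- **Discharging the typed missing input of class X9** (`Typed.X9.MissingInputAt W p`, i.e.
`MissingPPartAt W p`: `ord_p #Ш = ord_p #Ш_an`) at a rank-`0` SHA row carrying the two
certificates: on such a pair nothing is missing. Bookkeeping; per pair.
[cite: Miller2011LMS, Thm. 5.2 and Def. 1.1] [cite: CremonaMazur2000, §3] -/
theorem missingInputAt_of_classX9_of_visibleCongruence (hCha : thm52_padicValNat_shaOrder_le)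
    (hCT : exists_casselsTate_pairing (K := ℚ))
    (hGZK : rank_eq_analyticRank_of_analyticRank_le_one)
    (W : WeierstrassCurve ℚ) [W.IsElliptic] [W.IsGloballyMinimal] (p : ℕ) [Fact p.Prime]
    (hX9 : ClassX9 W p) (hr0 : W.analyticRank = 0)
    {N : ℕ} [NeZero N] {K : Type} [Field K] [NumberField K] (hK : IsImaginaryQuadratic K)
    (hH : SatisfiesHeegnerHypothesis N K) {P : (W.baseChange K).toAffine.Point}
    (hP : IsHeegnerPoint N W K P) (hnt : ¬ IsOfFinAddOrder P)
    (hpD : ¬ (p : ℤ) ∣ NumberField.discr K) (hpN : ¬ p ^ 2 ∣ N)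
    (hI : padicValNat p (AddSubgroup.zmultiples P).index ≤ 1)
    {q : ℚ} (hq : shaAn W = (q : ℂ)) (hv : padicValRat p q = 2)
    (W' : WeierstrassCurve ℚ) [W'.IsElliptic]
    (θ : geomTorsion W' (p : ℤ) ≃+ geomTorsion W (p : ℤ))
    (hθ : ∀ (σ : Field.absoluteGaloisGroup ℚ) (T : geomTorsion W' (p : ℤ)), θ (σ • T) = σ • θ T)
    (hrank : 2 ≤ W'.mordellWeilRank) (S : Finset (HeightOneSpectrum (𝓞 ℚ)))
    (hS : ∀ v : HeightOneSpectrum (𝓞 ℚ), v ∉ S →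
      W.HasGoodReductionAt v ∧ W'.HasGoodReductionAt v ∧ (p : 𝓞 ℚ) ∉ v.asIdeal)
    (hloc : ∀ v ∈ S, Nat.card (nsmulAddMonoidHom p :
      (W'.baseChange (v.adicCompletion ℚ)).toAffine.Point →+ _).ker = 1) :
    Typed.X9.MissingInputAt W p := by
  haveI : Finite W.sha := (hGZK W (by rw [hr0]; norm_num)).2
  exact Typed.missingPPartAt_of_bsdp W p
    (bsdp_of_classX9_of_visibleCongruence hCha hCT hGZK W p hX9 hr0 hK hH hP hnt hpD hpN hI hq hv W'
      θ hθ hrank S hS hloc)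

/-- **On such a pair Greenberg's `μ = 0` holds.** Granted the finite analytic certificate `hcert`
(one unit coefficient of the `Ω⁺_f`-normalised `p`-adic `L`-function `ϖ·L_p(f, α)`), the two
certificates give `BSDp W p` (`bsdp_of_classX9_of_visibleCongruence`) and gen 5's μ-typing converse
`Rank1Residual.X9.mu_eq_zero_of_bsdp` (Burungale–Castella–Skinner 2025 Thm. 1.1.2 (a) `hBCS`,
Greenberg LNM 1716 Thm. 4.1 `hGr`, the period unit `h5`, modularity `hmodP`/`hmodL`, GZK) turns it
into `D.mu = 0` for every cyclotomic dual datum `D` of `X(E/ℚ_∞)`: at a SHA row carrying the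
certificates the typed residue of class X9 (Greenberg's Conj. 1.11 instance,
`bsdpOnClassX9_at_iff_mu_eq_zero`) is SETTLED, not bypassed. Per pair; not a class theorem.
[cite: Miller2011LMS, Thm. 5.2] [cite: GreenbergLNM1716, Conj. 1.11 and Thm. 4.1 (p. 102)]
[cite: BurungaleCastellaSkinner2025, Thm. 1.1.2 (a)] [cite: CremonaMazur2000, §3] -/
theorem mu_eq_zero_of_classX9_of_visibleCongruence (hCha : thm52_padicValNat_shaOrder_le)
    (hCT : exists_casselsTate_pairing (K := ℚ))
    (hBCS : burungale_castella_skinner_charIdeal_eq_padicLFunction)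
    (hGr : greenberg_charValue_rankZero) (h5 : realPeriodRat_eq_unit_mul_plusPeriod)
    (hmodP : nonempty_modularParametrizationData) (hmodL : hasEntireLFunction_rat)
    (hGZK : rank_eq_analyticRank_of_analyticRank_le_one)
    (W : WeierstrassCurve ℚ) [W.IsElliptic] [W.IsGloballyMinimal] (p : ℕ) [Fact p.Prime]
    (hX9 : ClassX9 W p) (hr0 : W.analyticRank = 0)
    {N : ℕ} [NeZero N] {K : Type} [Field K] [NumberField K] (hK : IsImaginaryQuadratic K)
    (hH : SatisfiesHeegnerHypothesis N K) {P : (W.baseChange K).toAffine.Point}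
    (hP : IsHeegnerPoint N W K P) (hnt : ¬ IsOfFinAddOrder P)
    (hpD : ¬ (p : ℤ) ∣ NumberField.discr K) (hpN : ¬ p ^ 2 ∣ N)
    (hI : padicValNat p (AddSubgroup.zmultiples P).index ≤ 1)
    {q : ℚ} (hq : shaAn W = (q : ℂ)) (hv : padicValRat p q = 2)
    (W' : WeierstrassCurve ℚ) [W'.IsElliptic]
    (θ : geomTorsion W' (p : ℤ) ≃+ geomTorsion W (p : ℤ))
    (hθ : ∀ (σ : Field.absoluteGaloisGroup ℚ) (T : geomTorsion W' (p : ℤ)), θ (σ • T) = σ • θ T)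
    (hrank : 2 ≤ W'.mordellWeilRank) (S : Finset (HeightOneSpectrum (𝓞 ℚ)))
    (hS : ∀ v : HeightOneSpectrum (𝓞 ℚ), v ∉ S →
      W.HasGoodReductionAt v ∧ W'.HasGoodReductionAt v ∧ (p : 𝓞 ℚ) ∉ v.asIdeal)
    (hloc : ∀ v ∈ S, Nat.card (nsmulAddMonoidHom p :
      (W'.baseChange (v.adicCompletion ℚ)).toAffine.Point →+ _).ker = 1)
    (hcert : ∀ [NeZero (W.conductorNorm ℤ)] (f : CuspForm (Gamma0 (W.conductorNorm ℤ)) 2),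
        IsNewformOf W f → ∀ (ϖ : ℚ), (ϖ : ℝ) * W.realPeriodRat = plusPeriod f →
      ∃ n : ℕ, ‖PowerSeries.coeff n
        (PowerSeries.C (ϖ : ℚ_[p]) * padicLFunction f (unitRoot W p : ℚ_[p]))‖ = 1) :
    ∀ (κ : ZpExtension ℚ p) (γ : Field.absoluteGaloisGroup ℚ),
        κ.IsCyclotomic → κ.IsTopGenerator γ → IsCyclotomicVariable p γ →
      ∀ (D : W.SelmerDualData κ γ), D.mu = 0 := by
  have hbsd : BSDp W p :=
    bsdp_of_classX9_of_visibleCongruence hCha hCT hGZK W p hX9 hr0 hK hH hP hnt hpD hpN hI hq hv W' θ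
      hθ hrank S hS hloc
  exact Literature.NumberTheory.EllipticCurves.Rank1Residual.X9.mu_eq_zero_of_bsdp W p hBCS hGr h5
    hmodP hmodL hGZK (classX9_census_of_classX9 W p hX9) hr0 hbsd hcert

end Summit.BirchSwinnertonDyer.BirchSwinnertonDyer.Rank1Residual

end
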